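import Summits.CriticalPhenomena.CardyFormulaZ2.Theses.CardyRotToConf
import HarnessLib

/-!
# Sub-arc images are class invariants: the non-tracing clause of `CardyRotToConfR2SymmetryUpgrade`
# (stmt-CriticalPhenomena-0698) can be checked on ONE representative

By-product of the cdisprove unit (standing adversary, cycle 3). The crux's non-tracing clause — and
its straight-line analogue `NoTracedSegment` of the one-shot surgery programme (Disproof.lean §13) —
quantify over ALL representatives `c` of a `P D`-typical curve class and all parameter intervals
`[s, t]`, `s < t`. This file proves that the FAMILY OF SUB-ARC IMAGES `{c '' [s, t] | s ≤ t}` is the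
same for any two curves at reparametrisation distance zero (`image_Icc_eq_of_dist_eq_zero`: along
reparametrisations `φₙ` with `‖γ₁ - γ₂ ∘ φₙ‖ → 0`, a subsequential limit `[s', t']` of `[φₙ s, φₙ t]`
has `γ₁ '' [s, t] = γ₂ '' [s', t']`; only compactness of `[0, 1]` is used), hence every clause of the
shape "no representative traces a non-trivial sub-arc inside the set `A`" is equivalent to the same
clause for a single representative over all `s ≤ t` (`forall_rep_notrace_iff`). Consumers: provers of
`LimitFamily` / `LagHandOff` (non-tracing of a constructed limit family), the surgery programme
(non-tracing and segment-freeness transfer through `concatClass`), Beffara-type facts stated on the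
SLE parametrisation.
-/

noncomputable section

open Set Filter Topology

namespace Summit.CriticalPhenomena.CardyFormulaZ2.Theorems.CardyRotToConfR2SymmetryUpgrade.Negative

open Literature.Probability.RandomPlanarGeometry
open scoped unitInterval

variable {E : Type*} [MetricSpace E]

/-- Along a strictly monotone subsequence, `1/(ψ n + 1) → 0`-type bounds: `ψ n ≥ n`. [folklore] -/
theorem tendsto_one_div_subseq {ψ : ℕ → ℕ} (hψ : StrictMono ψ) :
    Tendsto (fun n => (1 : ℝ) / ((ψ n : ℝ) + 1)) atTop (𝓝 0) := by
  refine squeeze_zero (fun n => by positivity) (fun n => ?_) tendsto_one_div_add_atTop_nhds_zero_nat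
  have h : (n : ℝ) ≤ ψ n := by exact_mod_cast hψ.id_le n
  exact one_div_le_one_div_of_le (by positivity) (by linarith)

/-- **Sub-arc images are class invariants.** If `dist γ₁ γ₂ = 0` then for every parameter interval
`[s, t]` there is `[s', t']` with `γ₁ '' [s, t] = γ₂ '' [s', t']`. [cite: AizenmanBurchard1999, §2.1] -/
theorem image_Icc_eq_of_dist_eq_zero {γ₁ γ₂ : Curve E} (h : dist γ₁ γ₂ = 0) (s t : I)
    (hst : s ≤ t) : ∃ s' t' : I, s' ≤ t' ∧ (γ₁ : I → E) '' Icc s t = (γ₂ : I → E) '' Icc s' t' := by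
  -- reparametrisations `φ n` with sup distance `< 1/(n+1)`
  have hex : ∀ n : ℕ, ∃ φ : I ≃o I,
      dist γ₁.toContinuousMap (γ₂.reparam φ).toContinuousMap < 1 / ((n : ℝ) + 1) := fun n =>
    Curve.exists_dist_reparam_lt (by rw [h]; positivity)
  choose φ hφ using hex
  have hpt : ∀ n (x : I), dist (γ₁ x) (γ₂ (φ n x)) < 1 / ((n : ℝ) + 1) := fun n x =>
    (ContinuousMap.dist_apply_le_dist (f := γ₁.toContinuousMap)
      (g := (γ₂.reparam (φ n)).toContinuousMap) x).trans_lt (hφ n)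
  -- subsequence along which `(φ n s, φ n t)` converges
  obtain ⟨⟨s', t'⟩, -, ψ, hψ, hlim⟩ :=
    (isCompact_univ (X := I × I)).tendsto_subseq (x := fun n => (φ n s, φ n t)) fun n => mem_univ _
  have hs' : Tendsto (fun n => φ (ψ n) s) atTop (𝓝 s') := (continuous_fst.tendsto _).comp hlim
  have ht' : Tendsto (fun n => φ (ψ n) t) atTop (𝓝 t') := (continuous_snd.tendsto _).comp hlim
  have hle : s' ≤ t' := le_of_tendsto_of_tendsto' hs' ht' fun n => (φ (ψ n)).monotone hst
  refine ⟨s', t', hle, Set.Subset.antisymm ?_ ?_⟩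
  · -- `γ₁ '' [s,t] ⊆ γ₂ '' [s',t']`
    rintro _ ⟨x, hx, rfl⟩
    set u : ℕ → I := fun n => φ (ψ n) x with hu
    obtain ⟨v, -, χ, hχ, hv⟩ :=
      (isCompact_univ (X := I)).tendsto_subseq (x := u) fun n => mem_univ _
    have hv1 : s' ≤ v :=
      le_of_tendsto_of_tendsto' (hs'.comp hχ.tendsto_atTop) hv fun n => (φ (ψ (χ n))).monotone hx.1
    have hv2 : v ≤ t' :=
      le_of_tendsto_of_tendsto' hv (ht'.comp hχ.tendsto_atTop) fun n => (φ (ψ (χ n))).monotone hx.2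
    refine ⟨v, ⟨hv1, hv2⟩, ?_⟩
    -- `γ₂ (u (χ n)) → γ₂ v` and `→ γ₁ x`
    have h1 : Tendsto (fun n => γ₂ (u (χ n))) atTop (𝓝 (γ₂ v)) :=
      (γ₂.continuous.tendsto v).comp hv
    have h2 : Tendsto (fun n => γ₂ (u (χ n))) atTop (𝓝 (γ₁ x)) := by
      rw [tendsto_iff_dist_tendsto_zero]
      refine squeeze_zero (fun n => dist_nonneg) (fun n => ?_)
        (tendsto_one_div_subseq (hψ.comp hχ))
      rw [dist_comm]
      exact (hpt (ψ (χ n)) x).le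
    exact tendsto_nhds_unique h1 h2
  · -- `γ₂ '' [s',t'] ⊆ γ₁ '' [s,t]`
    rintro _ ⟨v, hv, rfl⟩
    -- clamp `v` into `[φ s, φ t]` and pull back
    set u : ℕ → I := fun n => max (φ (ψ n) s) (min v (φ (ψ n) t)) with hu
    have hu_mem : ∀ n, φ (ψ n) s ≤ u n ∧ u n ≤ φ (ψ n) t := fun n =>
      ⟨le_max_left _ _, max_le ((φ (ψ n)).monotone hst) (min_le_right _ _)⟩
    have hu_lim : Tendsto u atTop (𝓝 v) := by
      have : Tendsto u atTop (𝓝 (max s' (min v t'))) :=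
        hs'.max (tendsto_const_nhds.min ht')
      rwa [min_eq_left hv.2, max_eq_right hv.1] at this
    set x : ℕ → I := fun n => (φ (ψ n)).symm (u n) with hx
    have hx_mem : ∀ n, x n ∈ Icc s t := fun n => by
      refine ⟨?_, ?_⟩
      · have := (φ (ψ n)).symm.monotone (hu_mem n).1
        rwa [OrderIso.symm_apply_apply] at this
      · have := (φ (ψ n)).symm.monotone (hu_mem n).2
        rwa [OrderIso.symm_apply_apply] at this
    obtain ⟨y, hy, χ, hχ, hylim⟩ := (isCompact_Icc (a := s) (b := t)).tendsto_subseq hx_mem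
    refine ⟨y, hy, ?_⟩
    have h1 : Tendsto (fun n => γ₁ (x (χ n))) atTop (𝓝 (γ₁ y)) :=
      (γ₁.continuous.tendsto y).comp hylim
    have h2 : Tendsto (fun n => γ₁ (x (χ n))) atTop (𝓝 (γ₂ v)) := by
      have h3 : Tendsto (fun n => γ₂ (u (χ n))) atTop (𝓝 (γ₂ v)) :=
        (γ₂.continuous.tendsto v).comp (hu_lim.comp hχ.tendsto_atTop)
      refine (tendsto_iff_dist_tendsto_zero.2 ?_)
      have h4 : Tendsto (fun n => dist (γ₁ (x (χ n))) (γ₂ (u (χ n)))) atTop (𝓝 0) := by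
        refine squeeze_zero (fun n => dist_nonneg) (fun n => ?_)
          (tendsto_one_div_subseq (hψ.comp hχ))
        have := hpt (ψ (χ n)) (x (χ n))
        rw [hx, OrderIso.apply_symm_apply] at this
        exact this.le
      -- `dist (γ₁ xₙ) (γ₂ v) ≤ dist (γ₁ xₙ) (γ₂ uₙ) + dist (γ₂ uₙ) (γ₂ v)`
      have h5 : Tendsto (fun n => dist (γ₂ (u (χ n))) (γ₂ v)) atTop (𝓝 0) :=
        (tendsto_iff_dist_tendsto_zero.1 h3)
      refine squeeze_zero (fun n => dist_nonneg) (fun n => dist_triangle _ (γ₂ (u (χ n))) _) ?_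
      simpa using h4.add h5
    exact tendsto_nhds_unique h1 h2

/-- Class-level form: two representatives of one curve class have the same family of sub-arc
images. [folklore] -/
theorem image_Icc_eq_of_mk_eq_mk {γ₁ γ₂ : Curve E} (h : CurveClass.mk γ₁ = CurveClass.mk γ₂)
    (s t : I) (hst : s ≤ t) :
    ∃ s' t' : I, s' ≤ t' ∧ (γ₁ : I → E) '' Icc s t = (γ₂ : I → E) '' Icc s' t' :=
  image_Icc_eq_of_dist_eq_zero (CurveClass.mk_eq_mk_iff_dist_eq_zero.1 h) s t hst

/-- **One representative suffices.** A clause "no representative of the class of `γ₀` traces a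
non-trivial sub-arc (parameter interval `s < t`) inside `A`" holds iff it holds for `γ₀` itself over
all `s ≤ t` (degenerate intervals are trivially fine). This is the shape of the crux's non-tracing
clause (`A = frontier D`) and of `NoTracedSegment` (`A` a line). [folklore] -/
theorem forall_rep_notrace_iff (γ₀ : Curve E) (A : Set E) :
    (∀ c : Curve E, CurveClass.mk c = CurveClass.mk γ₀ →
        ∀ s t : I, s < t → (c : I → E) '' Icc s t ⊆ A → ((c : I → E) '' Icc s t).Subsingleton) ↔
      ∀ s t : I, s ≤ t → (γ₀ : I → E) '' Icc s t ⊆ A → ((γ₀ : I → E) '' Icc s t).Subsingleton := by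
  constructor
  · intro h s t hst hA
    rcases hst.lt_or_eq with hlt | rfl
    · exact h γ₀ rfl s t hlt hA
    · rw [Icc_self, image_singleton]
      exact subsingleton_singleton
  · intro h c hc s t hst hA
    obtain ⟨s', t', hle, heq⟩ := image_Icc_eq_of_mk_eq_mk hc s t hst.le
    rw [heq] at hA ⊢
    exact h s' t' hle hA

/-- The same with a predicate on sets in place of "inside `A`" (e.g. `Collinear ℝ`). [folklore] -/
theorem forall_rep_image_iff (γ₀ : Curve E) (p : Set E → Prop) :
    (∀ c : Curve E, CurveClass.mk c = CurveClass.mk γ₀ →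
        ∀ s t : I, s < t → p ((c : I → E) '' Icc s t) → ((c : I → E) '' Icc s t).Subsingleton) ↔
      ∀ s t : I, s ≤ t → p ((γ₀ : I → E) '' Icc s t) → ((γ₀ : I → E) '' Icc s t).Subsingleton := by
  constructor
  · intro h s t hst hp
    rcases hst.lt_or_eq with hlt | rfl
    · exact h γ₀ rfl s t hlt hp
    · rw [Icc_self, image_singleton]
      exact subsingleton_singleton
  · intro h c hc s t hst hp
    obtain ⟨s', t', hle, heq⟩ := image_Icc_eq_of_mk_eq_mk hc s t hst.le
    rw [heq] at hp ⊢
    exact h s' t' hle hp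

/-- **The crux's non-tracing clause, one-representative form.** For a chordal family `P`, the
non-tracing clause holds iff `P D`-a.e. class has SOME representative none of whose sub-arcs (over
`s ≤ t`) is a non-trivial subset of `frontier D`. [folklore] -/
theorem nonTracing_iff_exists_rep (P : ChordalFamily) :
    (∀ D : DobrushinDomain, ∀ᵐ γ ∂(P D), ∀ c : Curve ℂ, CurveClass.mk c = γ →
        ∀ s t : unitInterval, s < t → c '' Set.Icc s t ⊆ frontier D.carrier →
          (c '' Set.Icc s t).Subsingleton) ↔
      ∀ D : DobrushinDomain, ∀ᵐ γ ∂(P D), ∃ γ₀ : Curve ℂ, CurveClass.mk γ₀ = γ ∧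
        ∀ s t : unitInterval, s ≤ t → γ₀ '' Set.Icc s t ⊆ frontier D.carrier →
          (γ₀ '' Set.Icc s t).Subsingleton := by
  refine forall_congr' fun D => ⟨fun h => ?_, fun h => ?_⟩
  · filter_upwards [h] with γ hγ
    obtain ⟨γ₀, rfl⟩ := CurveClass.surjective_mk γ
    exact ⟨γ₀, rfl, (forall_rep_notrace_iff γ₀ _).1 hγ⟩
  · filter_upwards [h] with γ hγ
    obtain ⟨γ₀, rfl, h₀⟩ := hγ
    exact (forall_rep_notrace_iff γ₀ _).2 h₀

end Summit.CriticalPhenomena.CardyFormulaZ2.Theorems.CardyRotToConfR2SymmetryUpgrade.Negative
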